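import Literature.NumberTheory.LFunctions.WeilBochnerExtensionChar
import Literature.NumberTheory.LFunctions.WeilBochnerRepresentation
import HarnessLib

/-!
# The Bochner–Kreĭn representation of Weil's functional of a Dirichlet character on a window

Topic `Literature/NumberTheory/LFunctions`; the `χ`-twisted twin of `WeilBochnerRepresentation.lean`
(`W_χ = weilFunctionalChar χ`, `Q_χ = weilQuadraticChar χ`, rungs `WeilPositivityOnChar χ b` of
`WeilExplicitDirichlet.lean`).  Everything here is PROVED; no definitions, no named facts.

**Theorem** (`exists_measure_of_weilPositivityOnChar`, `weilPositivityOnChar_iff_exists_measure`).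
For every Dirichlet character `χ` and `b > 0`,

  `WeilPositivityOnChar χ b  ↔  ∃ μ ≥ 0 Borel measure on ℝ, ∀ g ∈ C_c^∞[-b, b],  Q_χ(g) = ∫ ‖ĝ(½ + it)‖² dμ(t)`,

with `μ` regular: a rung of the GRH arm at resolution `b` IS a positive-measure moment problem on the
critical line, exactly as for `ζ` — the Boas–Kac factorisation (`WeilBochner.exists_sq_eq_of_weilMellin_nonneg`)
and the cutoffs are character-free; the M. Riesz step is `WeilBochnerChar.exists_positive_extension_char`;
the tightness argument is the `ζ`-file's with `W_χ` (only real-linearity on tests and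
`Im Q_χ = 0`, `weilQuadraticChar_im`, are used).

## References

* M. G. Kreĭn, C. R. (Doklady) Acad. Sci. URSS 26 (1940), 17–22 [cite: Krein1940].
* A. Weil, *Sur les "formules explicites" de la théorie des nombres premiers* (1952), (11) and the
  «lemme» p. 262 [cite: Weil1952FormulesExplicites].
-/

noncomputable section

open Complex Filter Set MeasureTheory CompactlySupported FourierTransform
open scoped Real Topology ContDiff ComplexConjugate ENNReal

namespace Literature.NumberTheory.LFunctions

namespace WeilBochnerChar

variable {q : ℕ} (χ : DirichletCharacter ℂ q) {b : ℝ} {g k : ℝ → ℂ}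

/-! ## From a `χ`-rung to the cone of nonnegative transforms on `[-2b, 2b]` -/

/-- **`WeilPositivityOnChar χ b` ⇒ `Re W_χ ≥ 0` on the cone of nonnegative transforms of the window
`[-2b, 2b]`** (hermitian symmetrisation + Boas–Kac factorisation, both character-free).
[cite: Krein1940] -/
theorem re_weilFunctionalChar_nonneg_of_weilPositivityOnChar (hb : 0 < b)
    (hpos : WeilPositivityOnChar χ b) (hk : IsWeilTest k) (hks : tsupport k ⊆ Icc (-(2 * b)) (2 * b))
    (hre : ∀ t : ℝ, 0 ≤ (weilMellin k (1 / 2 + t * I)).re) : 0 ≤ (weilFunctionalChar χ k).re :=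
  re_weilFunctionalChar_nonneg_of_factor χ (R := 2 * b) hpos
    (fun _ hk hks h ↦ WeilBochner.exists_sq_eq_of_weilMellin_nonneg hb hk hks h) hk hks hre

/-! ## Cutoffs -/

/-- A sequence of continuous compactly supported cutoffs `χ_n : ℝ → [0, 1]` with `χ_n = 1` on
`[-(n+1), n+1]` (smooth bumps of radii `n+1 < n+2`). [folklore] -/
private theorem exists_cutoff_seq :
    ∃ χc : ℕ → ℝ → ℝ, (∀ n t, 0 ≤ χc n t) ∧ (∀ n t, χc n t ≤ 1) ∧
      (∀ (n : ℕ) (t : ℝ), |t| ≤ (n : ℝ) + 1 → χc n t = 1) ∧ (∀ n, Continuous (χc n)) ∧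
        ∀ n, HasCompactSupport (χc n) := by
  let B : ℕ → ContDiffBump (0 : ℝ) := fun n ↦
    ⟨(n : ℝ) + 1, (n : ℝ) + 2, by positivity, by linarith⟩
  refine ⟨fun n ↦ (B n : ℝ → ℝ), fun n t ↦ (B n).nonneg, fun n t ↦ (B n).le_one,
    fun n t ht ↦ ?_, fun n ↦ (B n).continuous, fun n ↦ (B n).hasCompactSupport⟩
  refine (B n).one_of_mem_closedBall ?_
  rw [Metric.mem_closedBall, Real.dist_eq, sub_zero]
  exact ht

/-! ## The representation on squares, for a given Riesz extension -/

/-- **Tightness and the identity `Q_χ(g) = ∫ ‖ĝ(½+it)‖² dμ`.**  Let `Λ` be a positive functional on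
`C_c(ℝ, ℝ)` with `Re W_χ(k) + Λ c ≥ 0` whenever `k` is a test supported in `[-2b, 2b]` and
`Re k̂(½+it) + c(t) ≥ 0` for all `t` (the output of `exists_positive_extension_char`), and let `μ` be
its Riesz–Markov–Kakutani measure.  Then for every test `g` supported in `[-b, b]` the function
`t ↦ ‖ĝ(½+it)‖²` is `μ`-integrable and `Q_χ(g) = W_χ(g ⋆ g̃) = ∫ ‖ĝ(½+it)‖² dμ(t)` (`Q_χ(g)` is real,
`weilQuadraticChar_im`).  Same sandwich as the `ζ`-file (`(g′)^(½+it) = -it·ĝ(½+it)`, Fatou, dominated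
convergence): only real-linearity of `W_χ` on tests is used. [cite: Krein1940] -/
theorem integrable_and_weilQuadraticChar_eq_integral (Λ : C_c(ℝ, ℝ) →ₚ[ℝ] ℝ)
    (hΛ : ∀ k : ℝ → ℂ, IsWeilTest k → tsupport k ⊆ Icc (-(2 * b)) (2 * b) →
      ∀ c : C_c(ℝ, ℝ), (∀ t : ℝ, 0 ≤ (weilMellin k (1 / 2 + t * I)).re + c t) →
        0 ≤ (weilFunctionalChar χ k).re + Λ c)
    (hg : IsWeilTest g) (hgs : tsupport g ⊆ Icc (-b) b) :
    Integrable (fun t : ℝ ↦ ‖weilMellin g (1 / 2 + t * I)‖ ^ 2) (RealRMK.rieszMeasure Λ) ∧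
      weilQuadraticChar χ g =
        ((∫ t, ‖weilMellin g (1 / 2 + t * I)‖ ^ 2 ∂(RealRMK.rieszMeasure Λ) : ℝ) : ℂ) := by
  set μ := RealRMK.rieszMeasure Λ with hμ
  -- the spectral density `F = ‖ĝ(½+it)‖²`
  set F : ℝ → ℝ := fun t ↦ ‖weilMellin g (1 / 2 + t * I)‖ ^ 2 with hF
  have hFc : Continuous F := by
    have h1 : Continuous fun t : ℝ ↦ (1 / 2 : ℂ) + t * I := by fun_prop
    exact ((continuous_weilMellin hg.1.continuous hg.2).comp h1).norm.pow 2
  have hF0 : ∀ t, 0 ≤ F t := fun t ↦ by positivity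
  -- the square `k = g ⋆ g̃`
  set k := weilConv g (weilReflect g) with hk_def
  have hk : IsWeilTest k := hg.weilConv hg.weilReflect
  have hks : tsupport k ⊆ Icc (-(2 * b)) (2 * b) := tsupport_weilConv_weilReflect_subset hg.2 hgs
  have hkF : ∀ t : ℝ, (weilMellin k (1 / 2 + t * I)).re = F t := fun t ↦ by
    rw [hk_def, weilMellin_weilConv_weilReflect_half hg, Complex.ofReal_re]
  have hQre : (weilQuadraticChar χ g).re = (weilFunctionalChar χ k).re := rfl
  -- the derivative square `k₊ = g′ ⋆ g̃′`, `Re k̂₊(½+it) = t² F(t)`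
  have hg' : IsWeilTest (deriv g) := hg.deriv
  have hg's : tsupport (deriv g) ⊆ Icc (-b) b := tsupport_deriv_subset.trans hgs
  set kp := weilConv (deriv g) (weilReflect (deriv g)) with hkp_def
  have hkp : IsWeilTest kp := hg'.weilConv hg'.weilReflect
  have hkps : tsupport kp ⊆ Icc (-(2 * b)) (2 * b) :=
    tsupport_weilConv_weilReflect_subset hg'.2 hg's
  have hkpF : ∀ t : ℝ, (weilMellin kp (1 / 2 + t * I)).re = t ^ 2 * F t := fun t ↦ by
    rw [hkp_def, weilMellin_weilConv_weilReflect_half hg', Complex.ofReal_re, weilMellin_deriv hg,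
      norm_mul]
    have : ‖-((1 : ℂ) / 2 + t * I - 1 / 2)‖ = |t| := by
      have e : -((1 : ℂ) / 2 + t * I - 1 / 2) = -(t * I) := by ring
      rw [e, norm_neg, norm_mul, Complex.norm_real, Complex.norm_I, mul_one, Real.norm_eq_abs]
    rw [this, mul_pow, sq_abs]
  -- cutoffs and the compactly supported densities `χ_n F`
  obtain ⟨χc, hχ0, hχ1, hχone, hχcc, hχcs⟩ := exists_cutoff_seq
  let c : ℕ → C_c(ℝ, ℝ) := fun n ↦
    ⟨⟨fun t ↦ χc n t * F t, (hχcc n).mul hFc⟩, (hχcs n).mul_right⟩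
  have hc : ∀ n t, c n t = χc n t * F t := fun n t ↦ rfl
  have hcint : ∀ n, ∫ t, χc n t * F t ∂μ = Λ (c n) := fun n ↦
    RealRMK.integral_rieszMeasure Λ (c n)
  have hcF0 : ∀ n t, 0 ≤ χc n t * F t := fun n t ↦ mul_nonneg (hχ0 n t) (hF0 t)
  have hcFle : ∀ n t, χc n t * F t ≤ F t := fun n t ↦ mul_le_of_le_one_left (hF0 t) (hχ1 n t)
  -- (1) lower bound `∫ χ_n F dμ ≤ Q(g)`
  have hlow : ∀ n, ∫ t, χc n t * F t ∂μ ≤ (weilQuadraticChar χ g).re := fun n ↦ by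
    have h := hΛ k hk hks (-(c n)) fun t ↦ by
      rw [hkF, CompactlySupportedContinuousMap.neg_apply, hc]
      linarith [hcFle n t]
    rw [map_neg] at h
    rw [hQre, hcint]
    linarith
  -- (2) upper bound `Q(g) ≤ ∫ χ_n F dμ + (n+1)⁻² Re W(k₊)`
  set ε : ℕ → ℝ := fun n ↦ (1 / ((n : ℝ) + 1)) ^ 2 with hε
  have hup : ∀ n, (weilQuadraticChar χ g).re ≤ ∫ t, χc n t * F t ∂μ + ε n * (weilFunctionalChar χ kp).re := by
    intro n
    have hkp1 := WeilBochner.isWeilTest_smul_real hkp (ε n)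
    have hk1 := WeilBochner.isWeilTest_smul_real hk (-1)
    have hk' : IsWeilTest (ε n • kp + (-1 : ℝ) • k) := hkp1.add hk1
    have hk's : tsupport (ε n • kp + (-1 : ℝ) • k) ⊆ Icc (-(2 * b)) (2 * b) :=
      (tsupport_add _ _).trans (union_subset ((WeilBochner.tsupport_smul_real_subset _ _).trans hkps)
        ((WeilBochner.tsupport_smul_real_subset _ _).trans hks))
    have hk'F : ∀ t : ℝ, (weilMellin (ε n • kp + (-1 : ℝ) • k) (1 / 2 + t * I)).re =
        ε n * (t ^ 2 * F t) - F t := fun t ↦ by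
      rw [weilMellin_add hkp1.1.continuous hkp1.2 hk1.1.continuous hk1.2, WeilBochner.weilMellin_smul_real,
        WeilBochner.weilMellin_smul_real, add_re, re_ofReal_mul, re_ofReal_mul, hkpF, hkF]
      ring
    have hk'W : (weilFunctionalChar χ (ε n • kp + (-1 : ℝ) • k)).re =
        ε n * (weilFunctionalChar χ kp).re - (weilFunctionalChar χ k).re := by
      rw [WeilBochnerChar.weilFunctionalChar_add χ hkp1 hk1, WeilBochnerChar.weilFunctionalChar_smul_real,
        WeilBochnerChar.weilFunctionalChar_smul_real, add_re, re_ofReal_mul, re_ofReal_mul]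
      ring
    have hn : (0 : ℝ) < (n : ℝ) + 1 := by positivity
    have h := hΛ _ hk' hk's (c n) fun t ↦ by
      rw [hk'F, hc]
      by_cases ht : |t| ≤ n + 1
      · rw [hχone n t ht]
        have : 0 ≤ ε n * (t ^ 2 * F t) := by positivity
        linarith
      · rw [not_le] at ht
        have h1 : 1 ≤ ε n * t ^ 2 := by
          have h2 : 1 ≤ |t| / ((n : ℝ) + 1) := by
            rw [le_div_iff₀ hn]
            linarith
          have h3 : ε n * t ^ 2 = (|t| / ((n : ℝ) + 1)) ^ 2 := by
            simp only [hε, div_pow, one_pow, sq_abs]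
            ring
          rw [h3]
          nlinarith
        have h4 : F t ≤ ε n * (t ^ 2 * F t) := by
          have := mul_le_mul_of_nonneg_right h1 (hF0 t)
          linarith [this]
        linarith [hcF0 n t]
    rw [hk'W] at h
    rw [hQre, hcint]
    linarith
  -- (3) `F ∈ L¹(μ)` by Fatou
  have hcmeas : ∀ n, Measurable fun t ↦ ENNReal.ofReal (χc n t * F t) := fun n ↦
    ((hχcc n).mul hFc).measurable.ennreal_ofReal
  have hcn_int : ∀ n, Integrable (fun t ↦ χc n t * F t) μ := fun n ↦
    (c n).continuous.integrable_of_hasCompactSupport (c n).hasCompactSupport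
  have hpt : ∀ t, ∀ᶠ n : ℕ in atTop, χc n t * F t = F t := fun t ↦ by
    refine (eventually_ge_atTop ⌈|t|⌉₊).mono fun n hn ↦ ?_
    rw [hχone n t ?_, one_mul]
    have : (⌈|t|⌉₊ : ℝ) ≤ n := by exact_mod_cast hn
    linarith [Nat.le_ceil |t|]
  have hptT : ∀ t, Tendsto (fun n : ℕ ↦ χc n t * F t) atTop (𝓝 (F t)) := fun t ↦
    tendsto_const_nhds.congr' ((hpt t).mono fun n hn ↦ hn.symm)
  have hlint : ∫⁻ t, ENNReal.ofReal (F t) ∂μ ≤ ENNReal.ofReal ((weilQuadraticChar χ g).re) := by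
    calc ∫⁻ t, ENNReal.ofReal (F t) ∂μ
        = ∫⁻ t, liminf (fun n ↦ ENNReal.ofReal (χc n t * F t)) atTop ∂μ := by
          refine lintegral_congr fun t ↦ ?_
          exact ((ENNReal.tendsto_ofReal (hptT t)).liminf_eq).symm
      _ ≤ liminf (fun n ↦ ∫⁻ t, ENNReal.ofReal (χc n t * F t) ∂μ) atTop :=
          lintegral_liminf_le hcmeas
      _ ≤ ENNReal.ofReal ((weilQuadraticChar χ g).re) := by
          refine liminf_le_of_frequently_le' (Frequently.of_forall fun n ↦ ?_)
          rw [← ofReal_integral_eq_lintegral_ofReal (hcn_int n) (ae_of_all _ (hcF0 n))]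
          exact ENNReal.ofReal_le_ofReal (hlow n)
  have hFint : Integrable F μ := by
    refine ⟨hFc.aestronglyMeasurable, ?_⟩
    rw [hasFiniteIntegral_iff_ofReal (ae_of_all _ hF0)]
    exact hlint.trans_lt ENNReal.ofReal_lt_top
  -- (4) `∫ χ_n F dμ → ∫ F dμ` by dominated convergence, and the sandwich
  have hlim : Tendsto (fun n ↦ ∫ t, χc n t * F t ∂μ) atTop (𝓝 (∫ t, F t ∂μ)) :=
    tendsto_integral_of_dominated_convergence F
      (fun n ↦ ((hχcc n).mul hFc).aestronglyMeasurable) hFint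
      (fun n ↦ ae_of_all _ fun t ↦ by
        rw [Real.norm_eq_abs, abs_of_nonneg (hcF0 n t)]
        exact hcFle n t)
      (ae_of_all _ hptT)
  have hεlim : Tendsto (fun n ↦ ε n * (weilFunctionalChar χ kp).re) atTop (𝓝 0) := by
    have h1 : Tendsto ε atTop (𝓝 0) := by
      have h0 := (tendsto_one_div_add_atTop_nhds_zero_nat (𝕜 := ℝ)).pow 2
      simp only [hε]
      simpa using h0
    simpa using h1.mul_const (weilFunctionalChar χ kp).re
  have hre : (weilQuadraticChar χ g).re = ∫ t, F t ∂μ := by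
    refine le_antisymm ?_ (le_of_tendsto' hlim hlow)
    have h2 := hlim.add hεlim
    rw [add_zero] at h2
    exact ge_of_tendsto' h2 hup
  refine ⟨hFint, Complex.ext ?_ ?_⟩
  · rw [hre, Complex.ofReal_re]
  · rw [weilQuadraticChar_im χ g, Complex.ofReal_im]

/-! ## The theorems -/

/-- **Bochner–Kreĭn representation of a rung of the GRH arm.**  If `WeilPositivityOnChar χ b`
(`b > 0`: `Re W_χ(g ⋆ g̃) ≥ 0` for every smooth `g` supported in `[-b, b]`), then there is a positive
regular Borel measure `μ` on `ℝ` such that for EVERY smooth `g` supported in `[-b, b]`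

  `W_χ(g ⋆ g̃) = ∫ ‖ĝ(½ + it)‖² dμ(t)`.

So a proved `χ`-rung says: to all observables of prime-side support in `[-2b, 2b]` the zeros of
`L(s, χ)` are a positive measure on the critical line (under GRH(χ), `μ = Σ_ρ m_ρ δ_{Im ρ}`,
`WeilBochner.charZeroHeightMeasure`).  The measure is not unique. [cite: Krein1940] -/
theorem exists_measure_of_weilPositivityOnChar (hb : 0 < b) (hpos : WeilPositivityOnChar χ b) :
    ∃ μ : Measure ℝ, μ.Regular ∧ ∀ g : ℝ → ℂ, IsWeilTest g → tsupport g ⊆ Icc (-b) b →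
      Integrable (fun t : ℝ ↦ ‖weilMellin g (1 / 2 + t * I)‖ ^ 2) μ ∧
        weilQuadraticChar χ g = ((∫ t, ‖weilMellin g (1 / 2 + t * I)‖ ^ 2 ∂μ : ℝ) : ℂ) := by
  obtain ⟨Λ, hΛ⟩ := WeilBochnerChar.exists_positive_extension_char χ (R := 2 * b) (by positivity)
    fun k hk hks hre ↦ re_weilFunctionalChar_nonneg_of_weilPositivityOnChar χ hb hpos hk hks hre
  exact ⟨RealRMK.rieszMeasure Λ, inferInstance, fun g hg hgs ↦
    integrable_and_weilQuadraticChar_eq_integral χ Λ hΛ hg hgs⟩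

/-- **A `χ`-rung ⟺ representability by a positive measure on the critical line.**  For `b > 0`:
`WeilPositivityOnChar χ b ↔ ∃ μ (measure on ℝ), ∀ g smooth with supp g ⊆ [-b, b],
Re W_χ(g ⋆ g̃) = ∫ ‖ĝ(½+it)‖² dμ(t)`.  With `riemannHypothesis_iff_forall_weilPositivityOnChar_holds`
(primitive `χ`, `q ≠ 1`) this reads: GRH(χ) holds iff for every bandwidth there is a positive measure
on the line reproducing Weil's (11) on all test autocorrelations of that bandwidth — the rungs of the
GRH arm are moment problems exactly as the rungs of `ζ`. [cite: Krein1940] -/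
theorem weilPositivityOnChar_iff_exists_measure (hb : 0 < b) :
    WeilPositivityOnChar χ b ↔ ∃ μ : Measure ℝ, ∀ g : ℝ → ℂ, IsWeilTest g → tsupport g ⊆ Icc (-b) b →
      (weilQuadraticChar χ g).re = ∫ t, ‖weilMellin g (1 / 2 + t * I)‖ ^ 2 ∂μ := by
  constructor
  · intro hpos
    obtain ⟨μ, -, hμ⟩ := exists_measure_of_weilPositivityOnChar χ hb hpos
    refine ⟨μ, fun g hg hgs ↦ ?_⟩
    rw [(hμ g hg hgs).2, Complex.ofReal_re]
  · rintro ⟨μ, hμ⟩ g hg hgs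
    rw [hμ g hg hgs]
    exact integral_nonneg fun t ↦ by positivity


end WeilBochnerChar

end Literature.NumberTheory.LFunctions

end
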